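import Literature.MathematicalPhysics.QuantumFieldTheory.Balaban1983to89.B9Cor35GpDirInputsAtOne

/-!
# `Balaban1983to89.B9Cor35GpDirAtCubeLetters` — [Balaban1985BackgroundPropagators] COROLLARY 3.5 p. 407 FOR PRINT's DIRICHLET CUBE LETTER
# `G′_□ = (Ω₀Δ′_{a,□}Ω₀)⁻¹` OF p. 394 ∕ pp. 408–409 (road P4): THEOREM 3.4's CONCLUSION (existence of `(padΔ_{□,Ω₀}(U′·1))⁻¹` and the transfer of every
# (3.42)-type entry) AT `U = 1` OVER THE CUBE SEQUENCE `{Ω_n(□)}` WITH DIRICHLET EXTERIOR, UNIFORMLY IN THE MEMBER AND THE COVER CUBE — Sect. B's engine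
# `B9Thm34SectBUniformR1.thm34_Gp_uniform` with EVERY `A`-INDEPENDENT BINDER DISCHARGED (r05 FILES 5a/5b, UNIT 1 `B9Cor35GpDirInputsAtOne`) —
# r05's FILE 6/7b `cor35_Gp_cube(_shared)` RE-PRESSED AT THE DIRICHLET LETTER (shared-constants form) — sub-row G-B9-LETTERS (site sector), seat dag-n06-c g32 UNIT 2

statement-level skeleton of published theorems with citation tags; proofs where landed; nothing here is a claim about the Yang–Mills mass gap

CITATION HEADER (lean-in-tree rule).  B9 = T. Bałaban, *Propagators for lattice gauge theories in a background field*, Commun. Math. Phys. **99** (1985)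
389–434 [Balaban1985BackgroundPropagators] (held `paper:balaban1985-cmp99-background-propagators`; journal page = PDF page + 388): Cor. 3.5 p. 407 l. 26–31
«The theorems hold also for the operators (3.24), (3.25) … for U′ satisfying (3.37) with the same vector potentials and with U = 1, these theorems were
proved in [4]»; p. 394 l. 24–33 «Δ′_a↾Ω₀ = Ω₀Δ′_aΩ₀ … Its inverse is denoted by G′, or G′(U)»; p. 408 (last lines)–p. 409 l. 5 «Ω₀(□) ⊂ □⁵ … the sequence
{Ω_n(□)} satisfies the assumptions of Corollary 3.6. The operators constructed for this sequence, which we denote by G′_□(U), … satisfy all the inequalities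
of Theorems 3.1–3.3»; Thm 3.4 p. 400; p. 399 l. 1–3 (constants depend on `d, L` and the bounds (2.1)–(2.2) only); p. 402 (3.60)–(3.65), «for α₁ sufficiently
small»; Thm 3.1 (3.42) p. 397.  [4] = [Balaban1984PropagatorsII] Prop. 2.2 (2.67) p. 234, Lemma 2.1 (2.59)–(2.61) pp. 233–234.  Rows B9.Cor3.5 × B9.Thm3.4
(cells only; no row head changes).

WHY THIS FILE (road P4 of the N06 h36b campaign; UNIT 1's header).  The Cor. 3.6 road at print's Dirichlet cube letter needs, per cover cube `□` and small
field `A` on `Ω₀(□)` (p. 408: `Ω₀(□) ⊂ □⁵ ⊂` a (3.35) cube, gauge `u`), the invertibility of `padΔ_{□,Ω₀}(e^{iηA}·1)` and Theorem 3.1's (3.42) entries for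
its inverse — Corollary 3.5: Theorem 3.4 for the padded Dirichlet letters at `U = 1`.  Sect. B's engine `thm34_Gp_uniform` (r06, lattice-free `a₁`, `B`)
delivers exactly this once its binders are supplied: the geometry and its axioms, [4] (2.61) and the p. 398 transfers (r05 FILE 5a, `geoCK i □`), the
stencil, the (3.19)/(3.24) sizes (r05 FILE 5b — the averaging structure of `Δ′_{a,□}` is unchanged by the Dirichlet compression), the letters `Δp, Gp` with
their laws and Theorem 3.1 (3.42)₁₋₃ for `Gp = conj b(η²(padΔ_{□,Ω₀}(1))⁻¹)` in all five orientations (UNIT 1 `thm31_dir_allOrientations`).  The (3.60)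
identity `Δp − conj b V′(A) = conj b(η⁻²padΔ_{□,Ω₀}(e^{iηA}·1))` for `A` supported well inside `Ω₀(□)` and the gauge covariance of the padded letters are
UNIT 3 (not here).

WHAT IS PROVED (0 `def`; 0 sorry; 0 new named facts; standard axioms):
* §1 ★★★`cor35_GpDir_cube` — `∃ δ₀ BG M₀ T₀ N₀, 0 < δ₀ ∧ 0 < BG ∧ ∃ a₁ > 0, ∃ B ≥ 0, ∀ i □ Rr H par (par 1 = 1), thresholds →` (a) the two located
  thresholds at `δ₀`, (b) the three base entries for `GpDirK` at `(B_G, δ₀)`, (c) `∀ α₁ ∈ [0, a₁] ∀ A kF sF` with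
  (3.59) sizes `C_q·α₁·w`, `C_q·α₁` and the five blockwise (3.37) bounds over the cube blocks (`T := shiftY i`, `U := 1`, `η := (geoCK i □).eta = |c_f|⁻¹`):
  the four conclusions of `thm34_Gp_uniform` VERBATIM at `Δp := DpDirK b i □ par`, `Gp := GpDirK b i □ par`, `blk := blkCubeY i □`, `kQ := kQCubeY i □ par 1`,
  `sQ := sQCubeY i □ par 1`, `cfun := cfunK i □`, `w := wK i □`, `Λ(α) := L⁴`, `a₀ := 1`, `d₀ := 1`.

PROOF.  Ours; assembly — r05's `cor35_Gp_cube_shared` with the letters exchanged.  `thm34_Gp_uniform` is invoked ONCE with `d := dB` (FILE 5a's door exponent at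
`δ₁`), `δ₀ := δ₁`, `BG := C₁` of UNIT 1's `thm31_dir_allOrientations`; its `∃ a₁ B` precede the lattice, so `a₁, B` depend on `d, L, M₂, C_q` only.

HONEST SCOPE / NOT CLAIMED.  `U = 1` at the Dirichlet cube (Cor. 3.5's case) for the PADDED letter (its `Ω₀`-compression is print's `G′_□`); the `A`-dependent
binders (`kF`, `sF` sizes, the five (3.37) readings) remain hypotheses; the identification of `Δp − conj b V′(A)` with the padded operator at `e^{iηA}·1` needs
`supp A` well inside `Ω₀(□)` (UNIT 3); the member thresholds and the transporter clause `par 1 = 1` are displayed; `‖1‖ ≤ 1` is assumed; the (3.43)/(3.46)–(3.47)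
entries are not part of this engine; at `U ≠ 1` road P4 needs the cube-level-keyed knit table `parKnitCubeY □` (not in the tree); nothing on `d = 4`, the
continuum, reflection positivity or the mass gap; NOT a node discharge; no row head changes.

RELATED IN THE TREE, NOT DUPLICATED: r05's `B9Cor35GpAtCubeLetters.cor35_Gp_cube` ∕ `B9Cor36GpCubeExtAtV.cor35_Gp_cube_shared` (same engine at the torus-levelled
letter `GpCubeY`; this file is the twin of the shared form);
n06-c's member chain `B9SectBGpFrameCodedY` (the same engine at the MEMBER's letters).
-/

noncomputable section

namespace Literature.MathematicalPhysics.QuantumFieldTheory.Balaban1983to89.B9Cor35GpDirAtCubeLetters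

open Literature.MathematicalPhysics.QuantumFieldTheory.Balaban1983to89
open Literature.MathematicalPhysics.QuantumFieldTheory.Balaban1983to89.B6RandomWalk (HasMajorant BlockSupp hasMajorant_mono Triangle254 Ineq261 c1_nonneg)
open Literature.MathematicalPhysics.QuantumFieldTheory.Balaban1983to89.B9Thm34Ext (toB6)
open Literature.MathematicalPhysics.QuantumFieldTheory.Balaban1983to89.B9Ineq347 (ScaleTransfer)
open Literature.MathematicalPhysics.QuantumFieldTheory.Balaban1983to89.B9Eq352DivFormLetters (conj)
open Literature.MathematicalPhysics.QuantumFieldTheory.Balaban1983to89.B9Eq352GradLetters (diffLetter)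
open Literature.MathematicalPhysics.QuantumFieldTheory.Balaban1983to89.B9Eq360Vprime (gPrimeExtEnd)
open Literature.MathematicalPhysics.QuantumFieldTheory.Balaban1983to89.B9Eq360VprimeLetters (vPrimeConc)
open Literature.MathematicalPhysics.QuantumFieldTheory.Balaban1983to89.B9Eq39Adjoint (covD covDstar)
open Literature.MathematicalPhysics.QuantumFieldTheory.Balaban1983to89.B9Eq352DivForm (tauB)
open Literature.MathematicalPhysics.QuantumFieldTheory.Balaban1983to89.B9Thm34SectBUniformR1 (thm34_Gp_uniform)
open Literature.MathematicalPhysics.QuantumFieldTheory.Balaban1983to89.B6KLevelCensusIndexV1 (KIdx kGeo)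
open Literature.MathematicalPhysics.QuantumFieldTheory.Balaban1983to89.B6Cover236MultiLevelBlocks (cubes)
open Literature.MathematicalPhysics.QuantumFieldTheory.Balaban1983to89.B6Prop22DerivMultiLevelTorus (dT)
open Literature.MathematicalPhysics.QuantumFieldTheory.Balaban1983to89.B9CubeLettersOpsL0 (oddMh cubeFamY)
open Literature.MathematicalPhysics.QuantumFieldTheory.Balaban1983to89.B9CubeLettersBondOpsL0 (BlkCubeY)
open Literature.MathematicalPhysics.QuantumFieldTheory.Balaban1983to89.B9Eq360DeltaPrimeACubeY (blkCubeY kQCubeY sQCubeY)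
open Literature.MathematicalPhysics.QuantumFieldTheory.Balaban1983to89.B9CubeGeometryInputs (geoCK geoCK_len geoCK_eta geoCK_eta_pos geoCK_L geoCK_dist
  geoCK_dist_axioms geoCK_len_pos geoCK_eta_le_len RM1 N1 exists_h261_geoCK hST_geoCK stencil_geoCK geoCK_site_nonempty)
open Literature.MathematicalPhysics.QuantumFieldTheory.Balaban1983to89.B9Cor35GpCubeInputsAtOne (wK cfunK wK_nonneg card_block_mul_wK_le norm_kQCubeY_one_le
  norm_sQCubeY_one_le abs_cfunK_le)
open Literature.MathematicalPhysics.QuantumFieldTheory.Balaban1983to89.B9Cor35GpDirInputsAtOne (DpDirK GpDirK DpDirK_mul_GpDirK smul_ringInverse_padDeltaCubeY_one_liftY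
  h342_1_of_liftY h342_2_inl_of_liftY h342_3_inr_of_liftY h342_2_inr_of_liftY h342_3_inl_of_liftY thm31_dir_allOrientations)
open Literature.MathematicalPhysics.QuantumFieldTheory.Balaban1983to89.Node00 (SiteY CfgY SiteParY toKT shiftY)
open scoped Matrix

variable {d ℓ : ℕ} {hd : 1 ≤ d + 1} {hL : Odd (ℓ + 1) ∧ 1 < ℓ + 1} {b₀ b₁ : ℝ}

/-! ## §1  ★★★ COROLLARY 3.5 FOR PRINT's DIRICHLET `G′_□`: `thm34_Gp_uniform` APPLIED AT `U := 1`, `g := geoCK i □`, the PADDED Dirichlet letters and UNIT 1's binders -/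

section Shared

variable {𝔸 : Type} [NormedRing 𝔸] [NormedAlgebra ℂ 𝔸] [CompleteSpace 𝔸]
variable {ι : Type} [Fintype ι] [DecidableEq ι] (b : Module.Basis ι ℝ 𝔸)

/-- ★★★ **COROLLARY 3.5 p. 407 FOR PRINT's DIRICHLET CUBE LETTER `G′_□ = (Ω₀Δ′_{a,□}Ω₀)⁻¹`, WITH THE SHARED CONSTANTS EXPOSED — THEOREM 3.4's CONCLUSION
AT `U = 1` OVER THE CUBE SEQUENCE `{Ω_n(□)}` WITH DIRICHLET EXTERIOR `Ω₀(□)`, UNIFORMLY IN THE MEMBER AND THE COVER CUBE**: there are `δ₀, B_G > 0`, thresholds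
`M₀, T₀, N₀` and Theorem 3.4's `a₁ > 0`, `B ≥ 0` — functions of `d, L`, the basis datum `M₂` and the (3.59) size `C_q` only (p. 399 l. 1–3) — such that for
every member above the thresholds, every cover cube `□`, every `Rr, H`, every transporter letter with `par 1 = 1`: (a) the two located member thresholds behind
the scale transfers and (2.61) at the rate `δ₀`; (b) Theorem 3.1's base entries at `U = 1` in conj-`b` form AT THE SAME `(B_G, δ₀)` for the padded letter
`Gp = conj b(η²(padΔ_{□,Ω₀}(1))⁻¹)`: `Gp ≺ B_G(Lⁿη)²e^{−δ₀d}`, `conj b(∇_k)·Gp`, `Gp·conj b(∇_k) ≺ B_GLⁿηe^{−δ₀d}` for every `k ∈ κ ⊕ κ`; (c) for every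
`0 ≤ α₁ ≤ a₁` and every vector potential `A` with the blockwise (3.37) bounds over the cube blocks and (3.59) kernels `kF, sF`: `gPrimeExtEnd Gp (conj b V′(A)·Gp)`
(`Δp = conj b(η⁻²padΔ_{□,Ω₀}(1))`, `V′(A)` the concrete (3.60) letter on r05 FILE 1's kernels) is the two-sided inverse of `Δp − conj b V′(A)`, and every left
entry `X·Gp ≺ B_G·P·e^{−δ₀d}` ∕ right entry `Gp·Y ≺ B_G·Lⁿη·e^{−δ₀d}` transfers to it at `(B, 9δ₀/10)` — `B9Thm34SectBUniformR1.thm34_Gp_uniform` with every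
`A`-independent binder DISCHARGED (r05 FILES 5a/5b for the geometry and sizes, UNIT 1 for the letters, laws and Theorem 3.1).  r05's
`B9Cor36GpCubeExtAtV.cor35_Gp_cube_shared` VERBATIM with `DpK ∕ GpK ↦ DpDirK ∕ GpDirK` (the shared form at once, so no consumer re-opens the `∃`).
[cite: Balaban1985BackgroundPropagators, Cor. 3.5 p.407, Thm 3.4 p.400, p.399 l.1–3, p.394 («Ω₀Δ′_aΩ₀ … G′»), p.408 («Ω₀(□) ⊂ □⁵»), p.409 l.1–5, (3.60)–(3.65) p.402, Thm 3.1 (3.42) p.397; Balaban1984PropagatorsII, Lemma 2.1 p.234, Prop. 2.2 p.234] -/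
theorem cor35_GpDir_cube (d ℓ : ℕ) (hℓ : 1 ≤ ℓ) (Cq M₂ : ℝ) (hCq : 0 ≤ Cq) (hM₂ : 0 ≤ M₂) (hrepr : ∀ (v : 𝔸) (j : ι), |b.repr v j| ≤ M₂ * ‖v‖)
    (h1 : ‖(1 : 𝔸)‖ ≤ 1) :
    ∃ δ₀ BG M₀ T₀ : ℝ, ∃ N₀ : ℕ, 0 < δ₀ ∧ 0 < BG ∧ ∃ a₁ : ℝ, 0 < a₁ ∧ ∃ B : ℝ, 0 ≤ B ∧
    ∀ {hd : 1 ≤ d + 1} {hL : Odd (ℓ + 1) ∧ 1 < ℓ + 1} {b₀ b₁ : ℝ} (i : KIdx d ℓ hd hL b₀ b₁) (c : ↥(cubes (toKT i).D.toDomains)) (Rr : ℝ) (H : Prop)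
      (par : SiteParY 𝔸 i), (∀ z w, par (fun _ _ => 1) z w = 1) →
      M₀ ≤ ((ℓ : ℝ) + 1) * (toKT i).Mh → N₀ + 1 ≤ (toKT i).R * ((ℓ + 1) * (toKT i).Mh) → T₀ ≤ RM1 i →
    (4 * Real.log ((ℓ : ℝ) + 1) / (9 / 5000 * δ₀) ≤ RM1 i ∧ N1 d ℓ (9 / 5000 * δ₀) + 1 ≤ (toKT i).R * ((ℓ + 1) * (toKT i).Mh)) ∧
    HasMajorant (g := toB6 (geoCK i c) Rr H) (fun p : SiteY i × ι => blkCubeY i c p.1) (GpDirK b i c par)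
      (fun a a' => BG * (geoCK i c).len a ^ 2 * Real.exp (-(δ₀ * (geoCK i c).dist a a'))) ∧
    (∀ k : Fin (d + 1) ⊕ Fin (d + 1), HasMajorant (g := toB6 (geoCK i c) Rr H) (fun p : SiteY i × ι => blkCubeY i c p.1)
      (conj b (diffLetter (shiftY i) (fun _ _ => (1 : 𝔸ˣ)) ((((geoCK i c).eta : ℂ))⁻¹) k) * GpDirK b i c par)
      (fun a a' => BG * (geoCK i c).len a * Real.exp (-(δ₀ * (geoCK i c).dist a a')))) ∧
    (∀ k : Fin (d + 1) ⊕ Fin (d + 1), HasMajorant (g := toB6 (geoCK i c) Rr H) (fun p : SiteY i × ι => blkCubeY i c p.1)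
      (GpDirK b i c par * conj b (diffLetter (shiftY i) (fun _ _ => (1 : 𝔸ˣ)) ((((geoCK i c).eta : ℂ))⁻¹) k))
      (fun a a' => BG * (geoCK i c).len a * Real.exp (-(δ₀ * (geoCK i c).dist a a')))) ∧
    ∀ (α₁ : ℝ), 0 ≤ α₁ → α₁ ≤ a₁ →
    ∀ (A : Fin (d + 1) → SiteY i → 𝔸) (kF : BlkCubeY i c → SiteY i → 𝔸 →L[ℝ] 𝔸) (sF : SiteY i → 𝔸 →L[ℝ] 𝔸),
      (∀ y x, blkCubeY i c x = y → ‖kF y x‖ ≤ Cq * α₁ * wK i c y) → (∀ x, ‖sF x‖ ≤ Cq * α₁) →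
      (∀ ν k x, ‖(((geoCK i c).eta : ℂ)⁻¹) • covDstar (shiftY i) (fun _ _ => (1 : 𝔸ˣ)) ν (A k) x‖ ≤ α₁ * ((geoCK i c).len (blkCubeY i c x) ^ 2)⁻¹) →
      (∀ μ ν x, ‖(((geoCK i c).eta : ℂ)⁻¹) • covD (shiftY i) (fun _ _ => (1 : 𝔸ˣ)) μ (A ν) x‖ ≤ α₁ * ((geoCK i c).len (blkCubeY i c x) ^ 2)⁻¹) →
      (∀ μ x, ‖(((geoCK i c).eta : ℂ)⁻¹) • covDstar (shiftY i) (fun _ _ => (1 : 𝔸ˣ)) μ (tauB (shiftY i) (fun _ _ => (1 : 𝔸ˣ)) μ (A μ)) x‖ ≤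
        α₁ * ((geoCK i c).len (blkCubeY i c x) ^ 2)⁻¹) →
      (∀ k x, ‖A k x‖ ≤ α₁ * ((geoCK i c).len (blkCubeY i c x))⁻¹) →
      (∀ ν k x, ‖tauB (shiftY i) (fun _ _ => (1 : 𝔸ˣ)) ν (A k) x‖ ≤ α₁ * ((geoCK i c).len (blkCubeY i c x))⁻¹) →
      (DpDirK b i c par - conj b (vPrimeConc (shiftY i) (fun _ _ => (1 : 𝔸ˣ)) (geoCK i c).eta A (blkCubeY i c) (kQCubeY i c par (fun _ _ => 1)) kF
          (sQCubeY i c par (fun _ _ => 1)) sF (cfunK i c))) *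
        (gPrimeExtEnd (GpDirK b i c par) (conj b (vPrimeConc (shiftY i) (fun _ _ => (1 : 𝔸ˣ)) (geoCK i c).eta A (blkCubeY i c)
          (kQCubeY i c par (fun _ _ => 1)) kF (sQCubeY i c par (fun _ _ => 1)) sF (cfunK i c)) * GpDirK b i c par)) = 1 ∧
      (gPrimeExtEnd (GpDirK b i c par) (conj b (vPrimeConc (shiftY i) (fun _ _ => (1 : 𝔸ˣ)) (geoCK i c).eta A (blkCubeY i c)
          (kQCubeY i c par (fun _ _ => 1)) kF (sQCubeY i c par (fun _ _ => 1)) sF (cfunK i c)) * GpDirK b i c par)) *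
        (DpDirK b i c par - conj b (vPrimeConc (shiftY i) (fun _ _ => (1 : 𝔸ˣ)) (geoCK i c).eta A (blkCubeY i c) (kQCubeY i c par (fun _ _ => 1)) kF
          (sQCubeY i c par (fun _ _ => 1)) sF (cfunK i c))) = 1 ∧
      (∀ (X : Module.End ℝ (SiteY i × ι → ℝ)) (P : BlkCubeY i c → ℝ), (∀ y, 0 ≤ P y) →
        HasMajorant (g := toB6 (geoCK i c) Rr H) (fun p : SiteY i × ι => blkCubeY i c p.1) (X * GpDirK b i c par)
          (fun a a' => BG * P a * Real.exp (-(δ₀ * (geoCK i c).dist a a'))) →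
        HasMajorant (g := toB6 (geoCK i c) Rr H) (fun p : SiteY i × ι => blkCubeY i c p.1)
          (X * (gPrimeExtEnd (GpDirK b i c par) (conj b (vPrimeConc (shiftY i) (fun _ _ => (1 : 𝔸ˣ)) (geoCK i c).eta A (blkCubeY i c)
            (kQCubeY i c par (fun _ _ => 1)) kF (sQCubeY i c par (fun _ _ => 1)) sF (cfunK i c)) * GpDirK b i c par)))
          (fun a a' => B * P a * Real.exp (-(9 / 10 * δ₀ * (geoCK i c).dist a a')))) ∧
      (∀ Y : Module.End ℝ (SiteY i × ι → ℝ),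
        HasMajorant (g := toB6 (geoCK i c) Rr H) (fun p : SiteY i × ι => blkCubeY i c p.1) (GpDirK b i c par * Y)
          (fun a a' => BG * (geoCK i c).len a * Real.exp (-(δ₀ * (geoCK i c).dist a a'))) →
        HasMajorant (g := toB6 (geoCK i c) Rr H) (fun p : SiteY i × ι => blkCubeY i c p.1)
          ((gPrimeExtEnd (GpDirK b i c par) (conj b (vPrimeConc (shiftY i) (fun _ _ => (1 : 𝔸ˣ)) (geoCK i c).eta A (blkCubeY i c)
            (kQCubeY i c par (fun _ _ => 1)) kF (sQCubeY i c par (fun _ _ => 1)) sF (cfunK i c)) * GpDirK b i c par)) * Y)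
          (fun a a' => B * (geoCK i c).len a * Real.exp (-(9 / 10 * δ₀ * (geoCK i c).dist a a')))) := by
  classical
  -- UNIT 1 §4: Theorem 3.1 for the padded Dirichlet kernel, all orientations, one rate `δ₁`, one constant `C₁`
  obtain ⟨δ₁, C₁, M₀, T₀, N₀, hδ₁, hC₁, h31⟩ := thm31_dir_allOrientations d ℓ hℓ
  -- FILE 5a: ONE (2.61) exponent `dB` at the rate `δ₁`
  obtain ⟨dB, h261⟩ := exists_h261_geoCK d ℓ hδ₁
  -- Sect. B's engine, lattice-free constants
  have hΛf : ∀ α : ℝ, 0 < α → (1 : ℝ) ≤ ((ℓ : ℝ) + 1) ^ 4 := fun α _ =>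
    one_le_pow₀ (by linarith [(Nat.cast_nonneg ℓ : (0 : ℝ) ≤ ℓ)])
  obtain ⟨a₁, ha₁, B, hB, H34⟩ := thm34_Gp_uniform (κ := Fin (d + 1)) b dB δ₁ C₁ Cq 1 1 M₂ (fun _ => ((ℓ : ℝ) + 1) ^ 4) hC₁ hCq zero_le_one hM₂ hδ₁
    hΛf hrepr
  refine ⟨δ₁, C₁, M₀, max T₀ (4 * Real.log ((ℓ : ℝ) + 1) / (9 / 5000 * δ₁)), max N₀ (N1 d ℓ (9 / 5000 * δ₁)), hδ₁, hC₁, a₁, ha₁, B, hB, ?_⟩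
  intro hd hL b₀ b₁ i c Rr H par hpar hM hN hT
  haveI : Nonempty (geoCK i c).Site := geoCK_site_nonempty i c
  have hN₀ : N₀ + 1 ≤ (toKT i).R * ((ℓ + 1) * (toKT i).Mh) := le_trans (Nat.succ_le_succ (le_max_left _ _)) hN
  have hN1 : N1 d ℓ (9 / 5000 * δ₁) + 1 ≤ (toKT i).R * ((ℓ + 1) * (toKT i).Mh) := le_trans (Nat.succ_le_succ (le_max_right _ _)) hN
  have hT₀ : T₀ ≤ RM1 i := (le_max_left _ _).trans hT
  have hT1 : 4 * Real.log ((ℓ : ℝ) + 1) / (9 / 5000 * δ₁) ≤ RM1 i := (le_max_right _ _).trans hT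
  obtain ⟨hdnn, htri, hrefl, hsym⟩ := geoCK_dist_axioms i c Rr H
  obtain ⟨hd₀B, hd₀F, hd₀0⟩ := stencil_geoCK i c
  obtain ⟨e1, e2, e3, e2', e3'⟩ := h31 i c Rr H hM hN₀ hT₀
  -- Theorem 3.1 in conj-`b` form (UNIT 1 §1 at the clause `hT` of the padded letter)
  have hT := smul_ringInverse_padDeltaCubeY_one_liftY i c par hpar
  have g342_1 := h342_1_of_liftY b i c hT Rr H e1
  have g342_2 : ∀ k : Fin (d + 1) ⊕ Fin (d + 1), HasMajorant (g := toB6 (geoCK i c) Rr H) (fun p : SiteY i × ι => blkCubeY i c p.1)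
      (conj b (diffLetter (shiftY i) (fun _ _ => (1 : 𝔸ˣ)) ((((geoCK i c).eta : ℂ))⁻¹) k) * GpDirK b i c par)
      (fun a a' => C₁ * (geoCK i c).len a * Real.exp (-(δ₁ * (geoCK i c).dist a a'))) := by
    rintro (μ | μ)
    · exact h342_2_inl_of_liftY b i c hT Rr H μ (e2 μ)
    · exact h342_2_inr_of_liftY b i c hT Rr H μ (e2' μ)
  have g342_3 : ∀ k : Fin (d + 1) ⊕ Fin (d + 1), HasMajorant (g := toB6 (geoCK i c) Rr H) (fun p : SiteY i × ι => blkCubeY i c p.1)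
      (GpDirK b i c par * conj b (diffLetter (shiftY i) (fun _ _ => (1 : 𝔸ˣ)) ((((geoCK i c).eta : ℂ))⁻¹) k))
      (fun a a' => C₁ * (geoCK i c).len a * Real.exp (-(δ₁ * (geoCK i c).dist a a'))) := by
    rintro (μ | μ)
    · exact h342_3_inl_of_liftY b i c hT Rr H μ (e3' μ)
    · exact h342_3_inr_of_liftY b i c hT Rr H μ (e3 μ)
  obtain ⟨hlaw1, hlaw2⟩ := DpDirK_mul_GpDirK b i c par hpar
  refine ⟨⟨hT1, hN1⟩, g342_1, g342_2, g342_3, ?_⟩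
  exact H34 (shiftY i) (fun _ _ => (1 : 𝔸ˣ)) (g := geoCK i c) (Rr := Rr) (H := H) (blkCubeY i c) (kQCubeY i c par (fun _ _ => 1))
    (sQCubeY i c par (fun _ _ => 1)) (cfunK i c) (wK i c) hdnn htri hrefl hsym (geoCK_len_pos i c) (geoCK_eta_le_len i c) (geoCK_eta_pos i c)
    (fun α hα hα1 => h261 i c Rr H hN1 α hα hα1.le) (hST_geoCK i c hδ₁ hT1)
    (fun _ _ => ⟨h1, by rw [inv_one, Units.val_one]; exact h1⟩) hd₀B hd₀F hd₀0 (wK_nonneg i c) (card_block_mul_wK_le i c)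
    (fun y x hx => by rw [← hx]; exact norm_kQCubeY_one_le i c par h1 hpar _ x) (norm_sQCubeY_one_le i c par h1 hpar) (abs_cfunK_le i c)
    hlaw1 hlaw2 g342_1 g342_2 g342_3

end Shared

end Literature.MathematicalPhysics.QuantumFieldTheory.Balaban1983to89.B9Cor35GpDirAtCubeLetters

end
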